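/-
Fleet lead `ym-wcr-19609-p1` (seat prover-ym-wcr-19609-p1-g2-0), route `WeakCouplingRates`, crux `BulkDominatesColdBoxW`
(stmt-QuantumFields-19609), line `dlr-chessboard` (v5): the ENERGY OF THE LINEARISED DATUM (YM side of `KernelMeanExpansion` /
`KernelCovExpansion`, census v3, item evidence #12).
-/
import Summits.QuantumFields.YangMills.Theorems.WeakCouplingRatesColdBoxChartPlaquette
import Summits.QuantumFields.YangMills.Theorems.WeakCouplingRatesColdBoxChartDict
import Summits.QuantumFields.YangMills.Theorems.WeakCouplingRatesDefs

/-!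
# Crux `BulkDominatesColdBoxW`: the energy of the LINEARISED datum — gnomonic coordinates of a small `SU(2)` configuration and the bound
# `Σ_c M_{ϑ_c}(s_c) ≤ Σ_p cost_p(W) + #P·362 m³`

The interfaces `KernelMeanExpansion` / `KernelCovExpansion` of the line `dlr-chessboard` (`Theorems/WeakCouplingRatesBulkDominatesColdBoxWDefs.lean`)
ask for one-colour Dirichlet data `ϑ c` and competitors `s c` of total Maxwell energy `≤ 16(2H+3)⁴β^{2δ−1}`; in the assembly these are the three
components of the GNOMONIC COORDINATES of a small configuration `W` on the enlarged box (the forest-gauged small-gauge copy of the crude-good datum).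
This file proves the deterministic half of that:

* `exists_gnomonic_coords` — every `U ∈ SU(2)` of cost `2 − Re tr U ≤ ½` is a chart point `gnomonicChart v = P(1, v)` with `|v|² ≤ 2·cost`
  (`su2Quat`, `quatToSU2_smul`, `sum_sq_le_two_mul_cost`);
* `formM_self_glue` — for a GLOBAL edge function `f`, gluing `f` (as datum) with `f` (as free values) gives the form `Σ_p (sCirc f (a+p))²`;
* `sum_formM_coords_le` — **the energy bound**: for `W` agreeing with chart points `P(1, v_e)`, `Σ_c v_{e,c}² ≤ m²` (`m ≤ ¼`), on the edges
  of the enlarged box, `Σ_c M_{v_c}(v_c) ≤ Σ_{p} cost_{a+p}(W) + #P·362m³` over the plaquette labels `P` of the enlarged box `{−1,…,2H+1}⁴`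
  (per plaquette: the chart linearisation `abs_plaqCostAt_sub_sum_sq_le_of_eq_gnomonic` of `Theorems/WeakCouplingRatesColdBoxChartPlaquette.lean`,
  seat ym-spine-20043-p1 g3).

With `W` = the truncated forest-gauged gauge copy of a crude-good datum (`cost ≤ β^{2δ−1}` on the enlarged box, `m ≲ H²β^{ε−1/2}` by
`su2_opDist1_le_uniform_of_exterior_le`) this is `≤ 6(2H+3)⁴(β^{2δ−1} + 362m³) ≤ 16(2H+3)⁴β^{2δ−1}` eventually.  No new definition; standard
axioms.  NOT a claim about the mass gap.
-/

set_option autoImplicit false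

noncomputable section

open Finset Quaternion
open Literature.Probability.LatticeModels
open Literature.MathematicalPhysics.QuantumLattice
open Literature.MathematicalPhysics.QuantumFieldTheory
open Literature.MathematicalPhysics.QuantumFieldTheory.LatticeMaxwell
open Literature.MathematicalPhysics.QuantumFieldTheory.AxialGauge

namespace Summit.QuantumFields.YangMills.Theorems.WeakCouplingRates

/-! ## §1 Gnomonic coordinates of a small `SU(2)` element -/

/-- **Gnomonic coordinates of a small element**: if `2 − Re tr U ≤ ½` then `U` is the chart point `gnomonicChart v = P(1, v)` of some
`v` with `|v|² ≤ 2·(2 − Re tr U)`. -/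
theorem exists_gnomonic_coords (U : Matrix.specialUnitaryGroup (Fin 2) ℂ)
    (hc : 2 - ((U : Matrix (Fin 2) (Fin 2) ℂ).trace).re ≤ 1 / 2) :
    ∃ v : Fin 3 → ℝ, gnomonicChart v = U ∧ ∑ i, v i ^ 2 ≤ 2 * (2 - ((U : Matrix (Fin 2) (Fin 2) ℂ).trace).re) := by
  set q := su2Quat U with hq
  -- `Re tr U = 2 re q`
  have hre : ((U : Matrix (Fin 2) (Fin 2) ℂ).trace).re = 2 * q.re := by
    have h := trace_quatToSU2_re (su2Quat_ne_zero U)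
    rw [quatToSU2_su2Quat, norm_su2Quat, inv_one, one_mul] at h
    exact h
  have hre_pos : 0 < q.re := by linarith
  set v : Fin 3 → ℝ := ![q.imI / q.re, q.imJ / q.re, q.imK / q.re] with hv
  have hgq : gnomonicQuat v = q.re⁻¹ • q := by
    ext <;> simp [gnomonicQuat, hv, div_eq_inv_mul, hre_pos.ne']
  have hU : gnomonicChart v = U := by
    rw [gnomonicChart, hgq, quatToSU2_smul (inv_pos.2 hre_pos), hq, quatToSU2_su2Quat]
  refine ⟨v, hU, ?_⟩
  have hc' : 2 - (((quatToSU2 (gnomonicQuat v) : Matrix.specialUnitaryGroup (Fin 2) ℂ) : Matrix (Fin 2) (Fin 2) ℂ).trace).re ≤ 1 / 2 := by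
    rw [← gnomonicChart, hU]; exact hc
  have h := sum_sq_le_two_mul_cost hc'
  rw [← gnomonicChart, hU] at h
  exact h

/-! ## §2 Gluing a global edge function with itself -/

section Glue

variable {d : ℕ} {pin : Literature.MathematicalPhysics.QuantumLattice.ZdEdge d → Prop} [DecidablePred pin] {a : Site d} {n : ℕ}

/-- Gluing a global edge function `f` as datum with its own values as free variables returns `f` on the block. -/
theorem glue_self_apply (f : Literature.MathematicalPhysics.QuantumLattice.ZdEdge d → ℝ)
    {e : Literature.MathematicalPhysics.QuantumLattice.ZdEdge d} (he : e ∈ boxEdgesAt a n) :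
    LatticeMaxwell.glue (pin := pin) a n f (fun e' : LatticeMaxwell.Free pin a n => f e'.1.1) e = f e := by
  by_cases hp : pin e
  · exact glue_apply_pin _ _ he hp
  · exact glue_apply_free f (fun e' : LatticeMaxwell.Free pin a n => f e'.1.1) ⟨⟨e, he⟩, hp⟩

/-- The four edges of a plaquette label of the box, translated, are edges of the translated box. -/
theorem shift_edges_mem_boxEdgesAt {p : Plaq d} (hp : p ∈ plaquettesIn (halfOpenBox d n)) :
    ((Plaq.shift a p).1, (Plaq.shift a p).2.1) ∈ boxEdgesAt a n ∧
      ((Plaq.shift a p).1 + Pi.single (Plaq.shift a p).2.1 1, (Plaq.shift a p).2.2) ∈ boxEdgesAt a n ∧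
      ((Plaq.shift a p).1 + Pi.single (Plaq.shift a p).2.2 1, (Plaq.shift a p).2.1) ∈ boxEdgesAt a n ∧
      ((Plaq.shift a p).1, (Plaq.shift a p).2.2) ∈ boxEdgesAt a n := by
  obtain ⟨hx, -, hxi, hxj, hxij⟩ := Plaq.mem_plaquettesIn.1 hp
  simp only [Plaq.shift_fst, Plaq.shift_snd]
  refine ⟨?_, ?_, ?_, ?_⟩ <;> rw [mem_boxEdgesAt, mem_boxEdges] <;> simp only [add_sub_cancel_right]
  · exact ⟨hx, hxi⟩
  · refine ⟨by rwa [add_right_comm, add_sub_cancel_right], ?_⟩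
    rw [add_right_comm, add_sub_cancel_right]; exact hxij
  · refine ⟨by rwa [add_right_comm, add_sub_cancel_right], ?_⟩
    rw [add_right_comm, add_sub_cancel_right, add_right_comm]; exact hxij
  · exact ⟨hx, hxj⟩

/-- **Self-glued form**: `M_f(f|_free) = Σ_p (sCirc f (a+p))²`. -/
theorem formM_self_glue (f : Literature.MathematicalPhysics.QuantumLattice.ZdEdge d → ℝ) :
    formM pin a n f (fun e' : LatticeMaxwell.Free pin a n => f e'.1.1) =
      ∑ p ∈ plaquettesIn (halfOpenBox d n), sCirc f (Plaq.shift a p) ^ 2 := by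
  unfold formM
  refine Finset.sum_congr rfl fun p hp => ?_
  obtain ⟨h1, h2, h3, h4⟩ := shift_edges_mem_boxEdgesAt (a := a) hp
  simp only [sCirc, glue_self_apply f h1, glue_self_apply f h2, glue_self_apply f h3, glue_self_apply f h4]

end Glue

/-! ## §3 The energy of the linearised configuration -/

/-- **Energy of the linearised datum.**  Let `W : ℤ⁴ → SU(2)` agree, on every edge of the enlarged box `{−1,…,2H+1}⁴`, with the chart
point `P(1, v_e)` of coordinates `v_e` of size `Σ_c v_{e,c}² ≤ m²` (`0 ≤ m ≤ ¼`).  Then the three one-colour Maxwell forms of the coordinate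
components (datum = free values = `v_c`) satisfy `Σ_c M_{v_c}(v_c) ≤ Σ_{p} cost_{a+p}(W) + #P · 362m³` over the plaquette labels `P` of the
enlarged box. -/
theorem sum_formM_coords_le (H : ℕ) (W : LGConfig 4 (Matrix.specialUnitaryGroup (Fin 2) ℂ))
    (v : Literature.MathematicalPhysics.QuantumLattice.ZdEdge 4 → Fin 3 → ℝ) {m : ℝ} (hm0 : 0 ≤ m) (hm : m ≤ 1 / 4)
    (hW : ∀ e ∈ boxEdgesAt dirCorner (2 * H + 3), W e = gnomonicChart (v e))
    (hv : ∀ e ∈ boxEdgesAt dirCorner (2 * H + 3), ∑ c, v e c ^ 2 ≤ m ^ 2) :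
    ∑ c : Fin 3, formM (fun e => e ∉ dirFreeEdges H) dirCorner (2 * H + 3) (fun e => v e c)
        (fun e' : DirFree H => v e'.1.1 c) ≤
      (∑ p ∈ plaquettesIn (halfOpenBox 4 (2 * H + 3)),
          plaqCostAt (fundamentalRep (Fin 2)) (Plaq.shift dirCorner p).1 (Plaq.shift dirCorner p).2.1 (Plaq.shift dirCorner p).2.2 W) +
        (plaquettesIn (halfOpenBox 4 (2 * H + 3))).card * (362 * m ^ 3) := by
  have hform : ∀ c : Fin 3, formM (fun e => e ∉ dirFreeEdges H) dirCorner (2 * H + 3) (fun e => v e c)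
      (fun e' : DirFree H => v e'.1.1 c) = ∑ p ∈ plaquettesIn (halfOpenBox 4 (2 * H + 3)), sCirc (fun e => v e c) (Plaq.shift dirCorner p) ^ 2 :=
    fun c => formM_self_glue (pin := fun e => e ∉ dirFreeEdges H) (a := dirCorner) (n := 2 * H + 3) (fun e => v e c)
  simp_rw [hform]
  have hconst : ((plaquettesIn (halfOpenBox 4 (2 * H + 3))).card : ℝ) * (362 * m ^ 3) =
      ∑ _p ∈ plaquettesIn (halfOpenBox 4 (2 * H + 3)), 362 * m ^ 3 := by
    rw [Finset.sum_const, nsmul_eq_mul]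
  rw [Finset.sum_comm, hconst, ← Finset.sum_add_distrib]
  refine Finset.sum_le_sum fun p hp => ?_
  obtain ⟨e1, e2, e3, e4⟩ := shift_edges_mem_boxEdgesAt (a := dirCorner) hp
  have h := abs_plaqCostAt_sub_sum_sq_le_of_eq_gnomonic W v (Plaq.shift dirCorner p).1 (Plaq.shift dirCorner p).2.1
    (Plaq.shift dirCorner p).2.2 hm0 hm (hW _ e1) (hW _ e2) (hW _ e3) (hW _ e4) (hv _ e1) (hv _ e2) (hv _ e3) (hv _ e4)
  have h' := (abs_le.1 h).1
  have hp' : ((Plaq.shift dirCorner p).1, (Plaq.shift dirCorner p).2.1, (Plaq.shift dirCorner p).2.2) = Plaq.shift dirCorner p := rfl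
  rw [hp'] at h'
  linarith

end Summit.QuantumFields.YangMills.Theorems.WeakCouplingRates

end
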